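import Mathlib
import HarnessLib
import Literature.MathematicalPhysics.QuantumFieldTheory.Balaban1983to89.StepInhabited
import Literature.MathematicalPhysics.QuantumFieldTheory.Balaban1983to89.AveragingRT
import Literature.MathematicalPhysics.QuantumFieldTheory.Balaban1983to89.MissingProofs
import Literature.MathematicalPhysics.QuantumFieldTheory.Balaban1983to89.B10Eq6DensityLevel
import Literature.MathematicalPhysics.QuantumFieldTheory.Balaban1983to89.B10LargeField
import Literature.MathematicalPhysics.QuantumFieldTheory.Balaban1983to89.BlockAveragingEMLHaarAC
import Literature.MathematicalPhysics.QuantumFieldTheory.Balaban1983to89.BlockAveragingEMLHaarACSUN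
import Literature.MathematicalPhysics.QuantumFieldTheory.Balaban1983to89.BlockAveragingEMLFibreLawSUN

/-!
# `Balaban1983to89.B10Eq2DensityTower` — [Balaban1985UV3] p. 256, displays **(1)–(2)**: the sequence of densities
# `ρ_{k+1} = Tρ_k` started at `ρ₀(U) = exp[−(1/g₀²)A(U) − E]` as ONE object on the cell's carrier of record, non-vacuously,
# with remark **(6)** for it, the characteristic functions of **(4)** / **(40)**, and the bridge to the abstract carrier
# `B10.RunData` of (5) / Theorem 1

T. Bałaban, *Ultraviolet stability of three-dimensional lattice pure gauge field theories*, Commun. Math. Phys. **102**,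
255–275 (1985) [Balaban1985UV3] (cell paper B10; journal page = PDF page + 254; p. 256 = [PDF 2] and p. 257 = [PDF 3] re-read
first-hand on the renders `run/shared/lean/pub/pub-balaban/b2b-balaban-ref1/pages/1985-cmp102-uv-stability-3d/…-p002-x2.png`,
`…-p003-x2.png`, 2026-08-23; «…» = verbatim).

HONEST FRAMING (mega-formalization `lit-balaban`, verbatim): statement-level skeleton of published theorems with
citation tags; proofs where landed; nothing here is a claim about the Yang–Mills mass gap.

## The printed text (p. 256 [PDF 2])

«We start with the action density  ρ₀(U) = exp[−(1/g₀²)A(U) − E],  (1)  where U is a gauge field configuration on the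
torus T, g₀² = g²ε^{4−d} = g²ε (d = 3), A(U) is the Wilson action, and E is a constant including normalization terms and
vacuum energy renormalization counterterms. This constant can be defined perturbatively by a finite order expansion of the
integral ∫dU (gauge fixing term) exp[−(1/g₀²)A(U)] with respect to g, but we prefer to give an inductive definition during
the proof. To the density ρ₀ we apply successively the renormalization transformations T described in [1,4]. This yields a
sequence of densities ρ_k defined inductively by  ρ_{k+1} = Tρ_k.  (2)  The density ρ_k(U) is a function of configurations
U defined on the lattice T^{(k)}. It is convenient to assume that all the lattices T^{(k)} are unit lattices …»; p. 257
[PDF 3], remark (6): «The bounds (5) imply bounds for partition functions, i.e. for the integrals ∫dUρ_k(U), hence by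
normalization identities  ∫dUρ_k = ∫dUT^kρ₀ = ∫dUρ₀ = Z^ε  (6)  they imply uniform in ε bounds for the partition function Z^ε.»

## Why this file exists (unit `lit-balaban-r07`, reader/typer and fold owner of B10; gen 51; rows B10.Eq1, B10.Eq2, B10.Eq6,
## bridge to B10.Eq5 / B10.Thm1)

Until now the tree carried (1)–(2) of THIS paper in two disconnected forms: (a) the abstract statement-level record
`…B10.RunData` (fields `Cfg`, `ρ`, `χ`, … WITHOUT bodies — the carrier over which (5), Theorem 1 (`B10.Thm1Printed`), Theorem 2 and
the whole `…B10Assembly` are typed), and (b) the cell's density-level vocabulary `…Step.DensityRG` / `…Step.DensityRGI` (tori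
`Site P k`, gauge fields `GaugeField P k G`, product Haar measure `fieldMeasure`, renormalization transformations as operators
specified by the push-forward identity `IsRT` of [Balaban1985Averaging] (10)), written for the d = 4 series with a large-field
operation `𝐑_k` in each step.  Gen 7 of this unit (`…B10Eq6DensityLevel`, p250473) put remark (6) on carrier (b) — but over
`Step.DensityRG`, whose field `T : ∀ k, RTOp P k G (av k)` is UNINHABITED for every gauge group with a non-degenerate Haar measure
as soon as one level averages axially (`…AveragingRT.isEmpty_rtOp_family`, cell GAPS G-f1-3 / DIVERGENCE F17): those theorems are
correct but vacuous for such data.  This file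

* §1–§2 gives (1)–(2) their BODIES on carrier (b) in the letters of [Balaban1985UV3]: `wilsonStart` (ρ₀) and `tower T g₀ E` :=
  `DensityRGI.free T (wilsonStart g₀ E)` — the trajectory `ρ_{k+1} = T_kρ_k` (`tower_ρ_succ`, by `rfl`) with NO large-field operation
  (`tower_R`: B10 applies T only; the 𝐑 of [Balaban1989LargeFieldI] belongs to d = 4), over the INHABITED carrier `RTOpI`;
* §3 proves (6) FOR THIS TOWER with the integrability / normalisation inputs discharged from the measurability of the Wilson action
  (`integral_tower_eq`: ∫dV_kρ_k = Z^ε for every k; `partitionFn_tower`: Z^ε = e^{−E}Z_W(g₀); `integral_tower_succ_eq`: ∫Tρ = ∫ρ);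
* §4 RE-DERIVES the (6) lower half of `…B10Eq6DensityLevel` §2 over `DensityRGI` (`partitionFn_ge_I`, `exp_neg_mul_wilsonZ_ge_I`,
  `le_log_wilsonZ_add_I`, `partitionFn_two_sided_I`, `partitionFn_ge_of_bounds5_I`) and §5 instantiates it at the tower
  (`tower_partitionFn_ge`, `tower_le_log_wilsonZ_add`, `tower_log_wilsonZ_sub_le`, `tower_E_mem_Icc`: the two UV bounds pin E in a
  window around log Z_W(g₀); U(N)/SU(N) with every side input discharged);
* §6 records the vacuity of the gen-7 typing as a kernel statement (`isEmpty_densityRG`, conditional on the `AveragingRT` witnesses)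
  and the EXISTENCE of the tower for the standard averaging family (`towerStd`, `exists_tower`);
* §7 types the χ of (4) as a density factor (`chi4` = the cell's `chiSmall` over all plaquettes; `chi4_eq_one_iff`: its
  support is gen 7's domain `plaqSmall`), so that the χ of (5) in the bridge can be THE characteristic function (4), and its
  scale-j analogue χ_j of (40) p. 266 (`chi40`; support = the cell's abstract `B10LargeField.Chi40` at `dev = |V(∂p) − 1|`,
  `chi40_eq_one_iff`; = the printed product, `chi40_eq_prod`);
* §8 BRIDGES to carrier (a): `runData D K χ bgA sites g I : B10.RunData` with `Cfg k := GaugeField P k G`, `ρ := D.ρ`, and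
  `bounds5At_runData_iff` / `bounds5_runData_iff` / `thm1Printed_runData_iff` — (5) and Theorem 1 READ on density towers — whence
  «(5) imply bounds for partition functions» BY NAME from `B10.Bounds5At` (`tower_partitionFn_le_of_bounds5At`,
  `tower_partitionFn_ge_of_bounds5At`, `…_chi4` with χ = (4) and no «χ = 1 on (4)» hypothesis).

v1.1 (same unit, gen 51; APPEND-ONLY — §1–§8 byte-identical; answers the lead՚s word of 2026-08-23T09:00:45Z on row B10.Eq2:
«print՚s block averaging of [1,4] NOT instantiated as `av k` — identification owed … by an instance member»).  §9 INSTANTIATES the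
tower at the paper՚s OWN averaging: `blockAvgStd ℰ k` = Bałaban՚s block averaging `BlockAveraging.blockAvg ℰ` of the pub-balaban cell
([Balaban1987RG1] (0.4) p. 253 = the tree՚s reading of [Balaban1985Averaging] (15), cell DIVERGENCE F6) in the standing range
`k + 1 ≤ m + K` (the transport averaging of `AveragingRT` beyond it, where the tori degenerate), with the renormalization transformation
`rtOpIBlockAvgStd ℰ` = the Radon–Nikodym transport `AveragingRT.rnTransport (avgFun ℰ)` of `dU` under `Ū` (the a.e. form of
[Balaban1985Averaging] (10)) under the T4 cell՚s absolute-continuity bracket `T4FiniteEpsInhabited.HaarAC` (row T4-D.G), and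
`towerBlockAvg ℰ` = (1)–(2) along it; (6) for it (`integral_towerBlockAvg_eq`); on SU(2) with the PRINTED inner operation exp[mean log]
(`ExpMeanLog.expMeanLogSU`) the bracket is DISCHARGED by the pub-balaban cell (`BlockAveragingEMLHaarAC.haarAC_avgFun_expMeanLogSU_of_le`),
so `towerPrintedSU2` is (1)–(2) with print՚s own T and NO hypothesis, and `integral_towerPrintedSU2_eq` is (6) for it; on SU(N) the same
under the cell՚s fibre law `EMLFibreLaw (Fin N)` (`towerPrintedSUN`; met at N = 2 by `emlFibreLaw_fin_two`).

v1.2 (same unit, gen 54; APPEND-ONLY — §1–§9 byte-identical but for ONE located citation fix, r10 SECOND-READ-B10 L-48 = CITELOC P89-006: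
the `blockAvgStd` tag «[Balaban1985Averaging] (15) p.20» → p.19, display (15) closing journal p. 19 of CMP **98**; + one import).  §10 records
that the fibre-law hypothesis of `towerPrintedSUN` is DISCHARGED FOR EVERY N ≥ 1 by the pub-balaban cell՚s theorem
`BlockAveragingEMLFibreLawSUN.emlFibreLaw_fin : EMLFibreLaw (Fin N)` (in the tree since 2026-08-19: the tangent injectivity of the ambient
exp-mean-log map `T4EMLTangentInjective.emlTangentLaw_specialUnitary` + Lemma A `T4HaarSUNLocalDiffeo`; `HaarAC` of (0.4) at the printed
small-loop average on every torus of the standing range = `BlockAveragingEMLFibreLawSUN.haarAC_avgFun_expMeanLogSU_SUN`): `towerPrintedSUNFree`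
is (1)–(2) with print՚s own T on SU(N), every N ≥ 1, NO hypothesis; (6), its lower half with no side input, and the Radon–Nikodym form of
(2) for it; the bracket in this file՚s binder shape (`hac_expMeanLogSU_SUN`); every fibre-law witness gives the same densities
(`towerPrintedSUN_ρ_eq_free`, proof irrelevance); at N = 2 it is `towerPrintedSU2` (`rfl`).  Theorem 1 p. 257 is
stated for «a semi-simple compact group Lie G» — SU(N), N ≥ 2, is the classical model family (U(N) is not semi-simple; a general `G`
stays under the bracket `HaarAC`, HONEST SCOPE (i)).

DICTIONARY print ↦ Lean: torus `T^{(k)}` (unit lattice of step k) ↦ `Site P k` / bonds `PBond P k` of `Setup` (`P : Params`,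
`P.d` = d, L = `P.L`); `U` on `T^{(k)}` ↦ `U : GaugeField P k G`; `A(U) = Σ_p[1 − Re tr U(∂p)]` (the Wilson action of the unit
lattice, cf. (5) «A^η(U) = Σ_p η^{−1}[1 − Re tr U(∂p)], η = L^{−k}» at k = 0) ↦ `wilsonAction4 U = wilsonAction 1 U`; `g₀` ↦ the real
parameter `g₀` (print: g₀² = g²ε^{4−d}; against the cell's running coupling `B10.gRun g L ε k = g(L^kε)^{1/2}`: `gRun_zero_sq`);
`dU` ↦ `fieldMeasure P k G`; `T` of [1,4] ↦ `(T k).T`, `T k : RTOpI P k G (av k)`; `Z^ε = ∫dUρ₀` ↦ `DensityRGI.partitionFn`;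
`Z_W(g₀) = ∫dU exp[−(1/g₀²)A(U)]` ↦ `Step.wilsonZ P G g₀`; the domain (4) ↦ `B10Eq6DensityLevel.plaqSmall P G K ε₁`, its characteristic function χ ↦ `chi4 P G ε₁ K`.

HONEST SCOPE. (i) The renormalization transformations «T described in [1,4]» enter as PARAMETERS `T k : RTOpI P k G (av k)` (§9, v1.1: instantiated at
Bałaban՚s block averaging — on SU(2) hypothesis-free, on SU(N) under `EMLFibreLaw` (v1.1; from v1.2 §10 hypothesis-free for every N ≥ 1,
the law being the tree՚s theorem `BlockAveragingEMLFibreLawSUN.emlFibreLaw_fin`), in general under `HaarAC`; beyond the standing range the transport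
averaging, where print has no lattices left) —
operators satisfying the push-forward identity of [Balaban1985Averaging] (10) for the averaging `av k` (cell DIVERGENCE F7: the
δ-function formula (Tρ)(V) = ∫dU Π_b δ(Ū(b)V(b)⁻¹)ρ(U) is replaced by its a.e. characterisation); the paper's own averaging operation
([Balaban1985Averaging] (13)–(15), block B5) is NOT instantiated here — `towerStd` uses the axial decimation inhabitant
`AveragingRT.stdAvg` only to certify that the bundle `(av, T)` is satisfiable.  (ii) `reTr` is the NORMALISED trace of the
`GaugeGroup` interface (cell DIVERGENCE D-b10.1 for (11)).  (iii) `P.d` is free (print: d = 3).  (iv) NOTHING here asserts that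
the tower satisfies (5): Theorem 1 stays the typed statement `B10.Thm1Printed`; §7 only identifies what that statement SAYS for
towers.  (v) `isEmpty_densityRG` is conditional on the two `AveragingRT` witnesses (a Haar-measurable set of measure strictly
between 0 and 1, a non-negative measurable non-integrable function), which exist on every non-trivial compact connected Lie
group but are not constructed in this file.  (vi) The gen-7 module `…B10Eq6DensityLevel` is left byte-identical (one-writer /
append-only rules); its carrier-free §1 (`plaqSmall`, `integral_ge_of_lower`, …) and §3 side inputs are used BY NAME.

WHAT THIS FILE PROVES (kernel, no `sorry`, no named facts; six definitions with bodies — `wilsonStart`, `tower`, `towerStd`,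
`chi4`, `chi40`, `runData` — (+ v1.1 §9: `blockAvgStd`, `rtOpIBlockAvgStd`, `towerBlockAvg`, `towerPrintedSU2`, `towerPrintedSUN`),, theorems otherwise; axioms standard;
+ v1.2 §10: `towerPrintedSUNFree` and eight theorems).  Value = SKELETON rows B10.Eq1 / B10.Eq2 typed WITH BODIES on the carrier
of record and B10.Eq6 made non-vacuous at the density level; NOT a proof of (5), NOT summit progress.
-/

noncomputable section

namespace Literature.MathematicalPhysics.QuantumFieldTheory.Balaban1983to89.B10Eq2DensityTower

open _root_.MeasureTheory
open Literature.MathematicalPhysics.QuantumFieldTheory.Balaban1983to89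
open Literature.MathematicalPhysics.QuantumFieldTheory.Balaban1983to89.Step

/-! ## §1 Display (1): the starting density `ρ₀(U) = exp[−(1/g₀²)A(U) − E]` -/

section Start

variable (P : Params) (G : Type*) [GaugeGroup G]

/-- **(1)** p. 256: *«ρ₀(U) = exp[−(1/g₀²)A(U) − E], where U is a gauge field configuration on the torus T, g₀² = g²ε^{4−d} =
g²ε (d = 3), A(U) is the Wilson action, and E is a constant»* — as a density on the finest lattice `T^{(0)}` of `Setup`, with
`A = wilsonAction4 = Σ_p [1 − Re tr U(∂p)]` (unit weight: «all the lattices T^{(k)} are unit lattices»). [cite: Balaban1985UV3, (1) p.256] -/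
def wilsonStart (g₀ E : ℝ) : Density P 0 G :=
  fun U => Real.exp (-(1 / g₀ ^ 2) * wilsonAction4 U - E)

variable {P G}

/-- Unfolding of (1). [cite: Balaban1985UV3, (1) p.256] -/
theorem wilsonStart_apply (g₀ E : ℝ) (U : GaugeField P 0 G) :
    wilsonStart P G g₀ E U = Real.exp (-(1 / g₀ ^ 2) * wilsonAction4 U - E) := rfl

/-- `ρ₀ > 0` pointwise. (elementary, serves (1)) [cite: Balaban1985UV3, (1) p.256] -/
theorem wilsonStart_pos (g₀ E : ℝ) (U : GaugeField P 0 G) : 0 < wilsonStart P G g₀ E U := Real.exp_pos _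

/-- `ρ₀ ≤ e^{−E}` pointwise, because the Wilson action is non-negative (`wilsonAction4_nonneg`). (elementary, serves (1))
[cite: Balaban1985UV3, (1) p.256] -/
theorem wilsonStart_le_exp_neg (g₀ E : ℝ) (U : GaugeField P 0 G) : wilsonStart P G g₀ E U ≤ Real.exp (-E) := by
  rw [wilsonStart_apply]
  refine Real.exp_le_exp.mpr ?_
  have h1 : 0 ≤ (1 / g₀ ^ 2) * wilsonAction4 U := mul_nonneg (by positivity) (wilsonAction4_nonneg U)
  linarith

/-- The Wilson action vanishes at the unit configuration `U ≡ 1` (every plaquette variable is `1`, `Re tr 1 = 1`). (elementary)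
[cite: Balaban1985UV3, (1) p.256] -/
theorem wilsonAction4_one {j : ℕ} : wilsonAction4 (fun _ : PBond P j => (1 : G)) = 0 := by
  unfold wilsonAction4 wilsonAction
  refine Finset.sum_eq_zero fun p _ => ?_
  simp [GaugeField.plaqHol, GaugeGroup.reTr_one]

/-- `ρ₀(1) = e^{−E}`: at the unit configuration the starting density IS the normalisation constant (the observation behind the
cell's audit reading of Theorem 1, GAPS G-B10-01: at k = 0 the bound (5) constrains −E). [cite: Balaban1985UV3, (1) p.256] -/
theorem wilsonStart_one (g₀ E : ℝ) : wilsonStart P G g₀ E (fun _ => 1) = Real.exp (-E) := by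
  rw [wilsonStart_apply, wilsonAction4_one]; simp

/-- The printed relation «g₀² = g²ε^{4−d} = g²ε (d = 3)» against the cell's running coupling `B10.gRun g L ε k = g(L^kε)^{1/2}` of
(5): at k = 0, `g₀ = g·ε^{1/2}`. [cite: Balaban1985UV3, (1) p.256, (5) p.256] -/
theorem gRun_zero (g L ε : ℝ) : B10.gRun g L ε 0 = g * Real.sqrt ε := by
  simp [B10.gRun]

/-- «g₀² = g²ε (d = 3)»: the square of the k = 0 running coupling. [cite: Balaban1985UV3, (1) p.256] -/
theorem gRun_zero_sq (g L ε : ℝ) (hε : 0 ≤ ε) : B10.gRun g L ε 0 ^ 2 = g ^ 2 * ε := by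
  rw [gRun_zero, mul_pow, Real.sq_sqrt hε]

end Start

/-! ## §2 Display (2): the tower `ρ_{k+1} = Tρ_k` on the inhabited carrier `Step.DensityRGI` -/

section Tower

variable {P : Params} {G : Type*} [GaugeGroup G] [MeasurableSpace G] [HaarData G] {av : ∀ j, Averaging P j G}

/-- **(2)** p. 256: *«To the density ρ₀ we apply successively the renormalization transformations T described in [1,4]. This
yields a sequence of densities ρ_k defined inductively by ρ_{k+1} = Tρ_k»* — the trajectory of `Step.DensityRGI` generated from
the Wilson start (1) by the renormalization transformations `T k` (operators on densities of `T^{(k)}` → `T^{(k+1)}` specified by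
the push-forward identity of [Balaban1985Averaging] (10), inhabited carrier `RTOpI`), with NO large-field operation
(`DensityRGI.free`: every `R k` the identity — this paper applies T only). [cite: Balaban1985UV3, (2) p.256] -/
def tower (T : ∀ k, RTOpI P k G (av k)) (g₀ E : ℝ) : DensityRGI P G av :=
  DensityRGI.free T (wilsonStart P G g₀ E)

/-- `ρ₀` of the tower is (1). [cite: Balaban1985UV3, (1) p.256] -/
theorem tower_ρ_zero (T : ∀ k, RTOpI P k G (av k)) (g₀ E : ℝ) : (tower T g₀ E).ρ 0 = wilsonStart P G g₀ E := rfl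

/-- **(2) verbatim:** `ρ_{k+1} = T_k ρ_k`. [cite: Balaban1985UV3, (2) p.256] -/
theorem tower_ρ_succ (T : ∀ k, RTOpI P k G (av k)) (g₀ E : ℝ) (k : ℕ) :
    (tower T g₀ E).ρ (k + 1) = (T k).T ((tower T g₀ E).ρ k) := rfl

/-- The tower's transformations are the given ones. [cite: Balaban1985UV3, (2) p.256] -/
theorem tower_T (T : ∀ k, RTOpI P k G (av k)) (g₀ E : ℝ) : (tower T g₀ E).T = T := rfl

/-- No large-field operation in [Balaban1985UV3]: every `R k` of the tower is the identity (contrast the d = 4 scheme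
`ρ_{k+1} = 𝐑_k(T_kρ_k)` of [Balaban1989LargeFieldI] (0.2), which `Step.DensityRGI` also accommodates). [cite: Balaban1985UV3, (2) p.256] -/
theorem tower_R (T : ∀ k, RTOpI P k G (av k)) (g₀ E : ℝ) (k : ℕ) : (tower T g₀ E).R k = id := rfl

/-- The tower is a Wilson start in the sense of `Step.DensityRGI.IsWilsonStart`. [cite: Balaban1985UV3, (1) p.256] -/
theorem tower_isWilsonStart (T : ∀ k, RTOpI P k G (av k)) (g₀ E : ℝ) : (tower T g₀ E).IsWilsonStart g₀ E :=
  fun _ => rfl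

/-- The identity operations preserve integrals (Setup `PreservesIntegral`), trivially. (elementary; serves (2)/(6))
[cite: Balaban1985UV3, (6) p.257] -/
theorem tower_preservesIntegral (T : ∀ k, RTOpI P k G (av k)) (g₀ E : ℝ) (k : ℕ) :
    PreservesIntegral ((tower T g₀ E).R k) :=
  fun _ => rfl

/-- The tower is normalised along the trajectory (`DensityRGI.StepNormalized`), trivially. (elementary; serves (2)/(6))
[cite: Balaban1985UV3, (6) p.257] -/
theorem tower_stepNormalized (T : ∀ k, RTOpI P k G (av k)) (g₀ E : ℝ) (K : ℕ) :
    (tower T g₀ E).StepNormalized K :=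
  DensityRGI.free_stepNormalized T _ K

/-- Every `ρ_k` of the tower is non-negative: `ρ₀ > 0` and each `T_k` preserves non-negativity (`RTOpI.pos`).
(elementary, serves (2)) [cite: Balaban1985UV3, (2) p.256] -/
theorem tower_ρ_nonneg (T : ∀ k, RTOpI P k G (av k)) (g₀ E : ℝ) : ∀ k V, 0 ≤ (tower T g₀ E).ρ k V := by
  intro k
  induction k with
  | zero => intro V; exact (wilsonStart_pos g₀ E V).le
  | succ k ih =>
    intro V
    show 0 ≤ (T k).T ((tower T g₀ E).ρ k) V
    exact (T k).pos _ ih V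

end Tower

/-! ## §3 Remark (6) for the tower: `∫dV_kρ_k = Z^ε = e^{−E}Z_W(g₀)` for every k, inputs discharged -/

section Six

variable {P : Params} {G : Type*} [GaugeGroup G] [MeasurableSpace G] [HaarData G] {av : ∀ j, Averaging P j G}

/-- `Z^ε = ∫dUρ₀ = e^{−E}·Z_W(g₀)` for the tower (the constant E factors out; no integrability needed).
[cite: Balaban1985UV3, (6) p.257] -/
theorem partitionFn_tower (T : ∀ k, RTOpI P k G (av k)) (g₀ E : ℝ) :
    (tower T g₀ E).partitionFn = Real.exp (-E) * wilsonZ P G g₀ :=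
  DensityRGI.partitionFn_eq_of_wilsonStart _ (tower_isWilsonStart T g₀ E)

/-- `ρ₀` is integrable for `dU` once the Wilson action is measurable (`StepInhabited.integrable_wilsonWeight`). (elementary;
serves (6)) [cite: Balaban1985UV3, (6) p.257] -/
theorem integrable_tower_zero (T : ∀ k, RTOpI P k G (av k)) (g₀ E : ℝ)
    (hA : Measurable fun U : GaugeField P 0 G => wilsonAction4 U) :
    Integrable ((tower T g₀ E).ρ 0) (fieldMeasure P 0 G) :=
  integrable_wilsonWeight hA g₀ E

/-- `Z^ε > 0` for the tower (measurable Wilson action). [cite: Balaban1985UV3, (6) p.257] -/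
theorem partitionFn_tower_pos (T : ∀ k, RTOpI P k G (av k)) (g₀ E : ℝ)
    (hA : Measurable fun U : GaugeField P 0 G => wilsonAction4 U) :
    0 < (tower T g₀ E).partitionFn :=
  DensityRGI.partitionFn_pos_of_wilsonStart _ (tower_isWilsonStart T g₀ E) hA

/-- Every `ρ_k` of the tower is integrable for `dV_k` (integrability is carried along (2) by the push-forward identity and
`Z^ε ≠ 0`, `DensityRGI.integrable_all`). (elementary; serves (6)) [cite: Balaban1985UV3, (6) p.257] -/
theorem integrable_tower (T : ∀ k, RTOpI P k G (av k)) (g₀ E : ℝ)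
    (hA : Measurable fun U : GaugeField P 0 G => wilsonAction4 U) (k : ℕ) :
    Integrable ((tower T g₀ E).ρ k) (fieldMeasure P k G) :=
  DensityRGI.integrable_all _ k (fun j _ => tower_preservesIntegral T g₀ E j) (integrable_tower_zero T g₀ E hA)
    (partitionFn_tower_pos T g₀ E hA).ne' k le_rfl

/-- **(6) for the tower, every k:** *«∫dUρ_k = ∫dUT^kρ₀ = ∫dUρ₀ = Z^ε»*. [cite: Balaban1985UV3, (6) p.257] -/
theorem integral_tower_eq (T : ∀ k, RTOpI P k G (av k)) (g₀ E : ℝ)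
    (hA : Measurable fun U : GaugeField P 0 G => wilsonAction4 U) (k : ℕ) :
    ∫ V, (tower T g₀ E).ρ k V ∂(fieldMeasure P k G) = (tower T g₀ E).partitionFn :=
  DensityRGI.integral_invariant_of_ne_zero _ k (fun j _ => tower_preservesIntegral T g₀ E j)
    (integrable_tower_zero T g₀ E hA) (partitionFn_tower_pos T g₀ E hA).ne' k le_rfl

/-- (6) with the Wilson start written out: `∫dV_kρ_k = e^{−E}·Z_W(g₀)`. [cite: Balaban1985UV3, (6) p.257] -/
theorem integral_tower_eq_wilsonZ (T : ∀ k, RTOpI P k G (av k)) (g₀ E : ℝ)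
    (hA : Measurable fun U : GaugeField P 0 G => wilsonAction4 U) (k : ℕ) :
    ∫ V, (tower T g₀ E).ρ k V ∂(fieldMeasure P k G) = Real.exp (-E) * wilsonZ P G g₀ := by
  rw [integral_tower_eq T g₀ E hA, partitionFn_tower]

/-- The one-step normalization identity *«∫dU Tρ = ∫dU ρ»* along the tower: `∫dV_{k+1}ρ_{k+1} = ∫dV_kρ_k`.
[cite: Balaban1985UV3, (6) p.257] -/
theorem integral_tower_succ_eq (T : ∀ k, RTOpI P k G (av k)) (g₀ E : ℝ)
    (hA : Measurable fun U : GaugeField P 0 G => wilsonAction4 U) (k : ℕ) :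
    ∫ V, (tower T g₀ E).ρ (k + 1) V ∂(fieldMeasure P (k + 1) G) = ∫ V, (tower T g₀ E).ρ k V ∂(fieldMeasure P k G) := by
  rw [integral_tower_eq T g₀ E hA, integral_tower_eq T g₀ E hA]

/-- **(6), upper half, for the tower:** a pointwise bound `ρ_K ≤ e^{c}` on `T^{(K)}` (the upper bound of (3)/(5) at k = K) gives
`Z^ε ≤ e^{c}` — *«they imply uniform in ε bounds for the partition function Z^ε»*. [cite: Balaban1985UV3, (6) p.257] -/
theorem partitionFn_tower_le_exp (T : ∀ k, RTOpI P k G (av k)) (g₀ E : ℝ)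
    (hA : Measurable fun U : GaugeField P 0 G => wilsonAction4 U) (K : ℕ) {c : ℝ}
    (hup : ∀ V, (tower T g₀ E).ρ K V ≤ Real.exp c) :
    (tower T g₀ E).partitionFn ≤ Real.exp c :=
  DensityRGI.partitionFn_le_exp_of_wilsonStart _ K (tower_isWilsonStart T g₀ E) hA
    (fun j _ => tower_preservesIntegral T g₀ E j) hup

/-- For a `RegularGaugeGroup` (`…UnitaryModel`: `reTr` measurable; instances U(N), SU(N)) the Wilson action is measurable —
the input `hA` of this section (`Missing.measurable_wilsonAction4`). (elementary; serves (1)/(6)) [cite: Balaban1985UV3, (1) p.256] -/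
theorem measurable_wilsonAction4_of_regular {G : Type*} [GaugeGroup G] [MeasurableSpace G] [RegularGaugeGroup G]
    {P : Params} {j : ℕ} : Measurable fun U : GaugeField P j G => wilsonAction4 U :=
  Missing.measurable_wilsonAction4 RegularGaugeGroup.measurable_reTr

end Six

/-! ## §4 Remark (6), lower half, over the INHABITED carrier `Step.DensityRGI` (re-derivation of `…B10Eq6DensityLevel` §2) -/

section LowerI

variable {P : Params} {G : Type*} [GaugeGroup G] [MeasurableSpace G] [HaarData G] {av : ∀ j, Averaging P j G}

/-- **Remark (6), lower half, density level, inhabited carrier.**  For a trajectory `ρ_{k+1} = R_k(T_kρ_k)` of `Step.DensityRGI`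
with normalised operations `R_k` (`PreservesIntegral`), an integrable `ρ₀` and `Z ≠ 0` (so that `∫dV_Kρ_K = Z`,
`DensityRGI.integral_invariant_of_ne_zero` = the identity (6)), a non-negative `ρ_K` which is `≥ e^{−c}` on the domain (4)
(the lower bound of (3) = (5) at k = K) gives `e^{−c}·haar{dist1 < δ}^{#bonds} ≤ Z` (`4δ ≤ ε₁`).  As `…B10Eq6DensityLevel.partitionFn_ge`,
whose carrier `Step.DensityRG` is uninhabited for non-degenerate Haar data (§6). [cite: Balaban1985UV3, (6) p.257] -/
theorem partitionFn_ge_I (D : DensityRGI P G av) (K : ℕ) (hR : ∀ k, k < K → PreservesIntegral (D.R k))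
    (hint0 : Integrable (D.ρ 0) (fieldMeasure P 0 G)) (hZ : D.partitionFn ≠ 0)
    (h0 : ∀ U, 0 ≤ D.ρ K U) {δ ε₁ c : ℝ} (h4 : 4 * δ ≤ ε₁)
    (hS : MeasurableSet {g : G | dist1 g < δ})
    (h3 : ∀ U ∈ B10Eq6DensityLevel.plaqSmall P G K ε₁, Real.exp (-c) ≤ D.ρ K U) :
    Real.exp (-c) * (((HaarData.haar : Measure G) {g : G | dist1 g < δ}).toReal) ^ Fintype.card (PBond P K) ≤
      D.partitionFn := by
  rw [← D.integral_invariant_of_ne_zero K hR hint0 hZ K le_rfl]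
  exact B10Eq6DensityLevel.integral_ge_of_lower (D.integrable_all K hR hint0 hZ K le_rfl) h0 h4 hS h3

/-- The same with the integrability of the densities along the trajectory as explicit hypotheses (the literal transcription of
`…B10Eq6DensityLevel.partitionFn_ge` to `DensityRGI`). [cite: Balaban1985UV3, (6) p.257] -/
theorem partitionFn_ge_I' (D : DensityRGI P G av) (K : ℕ) (hR : ∀ k, k < K → PreservesIntegral (D.R k))
    (hint : ∀ k, k < K → Integrable (D.ρ k) (fieldMeasure P k G)) (hintK : Integrable (D.ρ K) (fieldMeasure P K G))
    (h0 : ∀ U, 0 ≤ D.ρ K U) {δ ε₁ c : ℝ} (h4 : 4 * δ ≤ ε₁)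
    (hS : MeasurableSet {g : G | dist1 g < δ})
    (h3 : ∀ U ∈ B10Eq6DensityLevel.plaqSmall P G K ε₁, Real.exp (-c) ≤ D.ρ K U) :
    Real.exp (-c) * (((HaarData.haar : Measure G) {g : G | dist1 g < δ}).toReal) ^ Fintype.card (PBond P K) ≤
      D.partitionFn := by
  rw [← D.integral_invariant K hR hint K le_rfl]
  exact B10Eq6DensityLevel.integral_ge_of_lower hintK h0 h4 hS h3

/-- **Both halves of (6), inhabited carrier:** `e^{−c} ≤ ρ_K` on (4) and `ρ_K ≤ e^{c′}` everywhere give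
`e^{−c}·m^{#bonds} ≤ Z ≤ e^{c′}`, `m = haar{dist1 < δ}`. [cite: Balaban1985UV3, (3) p.256, (6) p.257] -/
theorem partitionFn_two_sided_I (D : DensityRGI P G av) (K : ℕ) (hR : ∀ k, k < K → PreservesIntegral (D.R k))
    (hint0 : Integrable (D.ρ 0) (fieldMeasure P 0 G)) (hZ : D.partitionFn ≠ 0)
    (h0 : ∀ U, 0 ≤ D.ρ K U) {δ ε₁ c c' : ℝ} (h4 : 4 * δ ≤ ε₁)
    (hS : MeasurableSet {g : G | dist1 g < δ})
    (h3 : ∀ U ∈ B10Eq6DensityLevel.plaqSmall P G K ε₁, Real.exp (-c) ≤ D.ρ K U)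
    (hup : ∀ U, D.ρ K U ≤ Real.exp c') :
    Real.exp (-c) * (((HaarData.haar : Measure G) {g : G | dist1 g < δ}).toReal) ^ Fintype.card (PBond P K) ≤
        D.partitionFn ∧ D.partitionFn ≤ Real.exp c' :=
  ⟨partitionFn_ge_I D K hR hint0 hZ h0 h4 hS h3,
    D.partitionFn_le_exp K c' hR (fun k hk => D.integrable_all K hR hint0 hZ k hk.le) hup⟩

/-- **Wilson start, inhabited carrier:** with `ρ₀ = exp[−(1/g₀²)A − E]` and a measurable Wilson action the lower half reads
`e^{−c}·m^{#bonds} ≤ e^{−E}·Z_W(g₀)` — integrability of `ρ₀` and `Z ≠ 0` are now DERIVED (as `…B10Eq6DensityLevel.exp_neg_mul_wilsonZ_ge`).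
[cite: Balaban1985UV3, (1) p.256, (6) p.257] -/
theorem exp_neg_mul_wilsonZ_ge_I (D : DensityRGI P G av) (K : ℕ) {g₀ E : ℝ} (hW : D.IsWilsonStart g₀ E)
    (hA : Measurable fun U : GaugeField P 0 G => wilsonAction4 U)
    (hR : ∀ k, k < K → PreservesIntegral (D.R k)) (h0 : ∀ U, 0 ≤ D.ρ K U) {δ ε₁ c : ℝ} (h4 : 4 * δ ≤ ε₁)
    (hS : MeasurableSet {g : G | dist1 g < δ})
    (h3 : ∀ U ∈ B10Eq6DensityLevel.plaqSmall P G K ε₁, Real.exp (-c) ≤ D.ρ K U) :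
    Real.exp (-c) * (((HaarData.haar : Measure G) {g : G | dist1 g < δ}).toReal) ^ Fintype.card (PBond P K) ≤
      Real.exp (-E) * wilsonZ P G g₀ := by
  rw [← D.partitionFn_eq_of_wilsonStart hW]
  exact partitionFn_ge_I D K hR (D.integrable_wilsonStart hW hA) (D.partitionFn_pos_of_wilsonStart hW hA).ne'
    h0 h4 hS h3

/-- **THE LOWER UV BOUND PINS `E` FROM ABOVE, inhabited carrier** (partner of `DensityRGI.log_wilsonZ_sub_le`; cell GAPS G-pv06-1):
with `m = haar{dist1 < δ} > 0` and `n = #bonds`, `E ≤ log Z_W(g₀) + c + n·log m⁻¹` (as `…B10Eq6DensityLevel.le_log_wilsonZ_add`).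
[cite: Balaban1985UV3, (6) p.257] -/
theorem le_log_wilsonZ_add_I (D : DensityRGI P G av) (K : ℕ) {g₀ E : ℝ} (hW : D.IsWilsonStart g₀ E)
    (hA : Measurable fun U : GaugeField P 0 G => wilsonAction4 U)
    (hR : ∀ k, k < K → PreservesIntegral (D.R k)) (h0 : ∀ U, 0 ≤ D.ρ K U) {δ ε₁ c : ℝ} (h4 : 4 * δ ≤ ε₁)
    (hS : MeasurableSet {g : G | dist1 g < δ})
    (hm : 0 < ((HaarData.haar : Measure G) {g : G | dist1 g < δ}).toReal)
    (h3 : ∀ U ∈ B10Eq6DensityLevel.plaqSmall P G K ε₁, Real.exp (-c) ≤ D.ρ K U) :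
    E ≤ Real.log (wilsonZ P G g₀) + c +
      (Fintype.card (PBond P K) : ℝ) * Real.log ((HaarData.haar : Measure G) {g : G | dist1 g < δ}).toReal⁻¹ := by
  set m : ℝ := ((HaarData.haar : Measure G) {g : G | dist1 g < δ}).toReal with hm_def
  set n : ℕ := Fintype.card (PBond P K) with hn_def
  have h := exp_neg_mul_wilsonZ_ge_I D K hW hA hR h0 h4 hS h3
  have hlhs : 0 < Real.exp (-c) * m ^ n := mul_pos (Real.exp_pos _) (pow_pos hm n)
  have hZ : 0 < wilsonZ P G g₀ := wilsonZ_pos_of_measurable hA g₀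
  have hlog := Real.log_le_log hlhs h
  rw [Real.log_mul (Real.exp_pos _).ne' (pow_pos hm n).ne', Real.log_exp, Real.log_pow,
    Real.log_mul (Real.exp_pos _).ne' hZ.ne', Real.log_exp] at hlog
  rw [Real.log_inv]
  linarith

/-- **(5) at `k = K` ⇒ the lower bound for `Z`, inhabited carrier**, in the shape of `…B10.Bounds5At` (as
`…B10Eq6DensityLevel.partitionFn_ge_of_bounds5`): `χ = 1` on (4), `χ(U)·exp[−g_K^{−2}A(U) − O1·S] ≤ ρ_K(U)` pointwise and
`A ≤ a·S` on (4) (the [7]-regularity input; `S` = `|T₁^{(K)}|`) give `exp(−(O1 + a·g_K^{−2})·S)·m^{#bonds} ≤ Z`.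
[cite: Balaban1985UV3, (5) p.256, (6) p.257] -/
theorem partitionFn_ge_of_bounds5_I (D : DensityRGI P G av) (K : ℕ) (hR : ∀ k, k < K → PreservesIntegral (D.R k))
    (hint0 : Integrable (D.ρ 0) (fieldMeasure P 0 G)) (hZ : D.partitionFn ≠ 0)
    (h0 : ∀ U, 0 ≤ D.ρ K U) {δ ε₁ : ℝ} (h4 : 4 * δ ≤ ε₁)
    (hS : MeasurableSet {g : G | dist1 g < δ}) {χ A : Density P K G} {gK O1 a S : ℝ}
    (hχ : ∀ U ∈ B10Eq6DensityLevel.plaqSmall P G K ε₁, χ U = 1)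
    (h5 : ∀ U, χ U * Real.exp (-(gK⁻¹ ^ 2 * A U) - O1 * S) ≤ D.ρ K U)
    (hreg : ∀ U ∈ B10Eq6DensityLevel.plaqSmall P G K ε₁, A U ≤ a * S) :
    Real.exp (-((O1 + a * gK⁻¹ ^ 2) * S)) *
        (((HaarData.haar : Measure G) {g : G | dist1 g < δ}).toReal) ^ Fintype.card (PBond P K) ≤ D.partitionFn := by
  refine partitionFn_ge_I D K hR hint0 hZ h0 h4 hS (c := (O1 + a * gK⁻¹ ^ 2) * S) fun U hU => ?_
  have h := h5 U
  rw [hχ U hU, one_mul] at h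
  refine le_trans (Real.exp_le_exp.mpr ?_) h
  have hA := hreg U hU
  have hg : 0 ≤ gK⁻¹ ^ 2 := sq_nonneg _
  nlinarith [mul_le_mul_of_nonneg_left hA hg]

end LowerI

/-! ## §5 Remark (6), lower half and the window for `E`, FOR THE TOWER (every side input but `hS`/`hm` discharged; U(N), SU(N) fully) -/

section LowerTower

variable {P : Params} {G : Type*} [GaugeGroup G] [MeasurableSpace G] [HaarData G] {av : ∀ j, Averaging P j G}

/-- **(6), lower half, for the tower (1)–(2):** `e^{−c} ≤ ρ_K` on the domain (4) ⇒ `e^{−c}·m^{#bonds} ≤ Z^ε = e^{−E}Z_W(g₀)`.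
[cite: Balaban1985UV3, (6) p.257] -/
theorem tower_partitionFn_ge (T : ∀ k, RTOpI P k G (av k)) (g₀ E : ℝ)
    (hA : Measurable fun U : GaugeField P 0 G => wilsonAction4 U) (K : ℕ) {δ ε₁ c : ℝ} (h4 : 4 * δ ≤ ε₁)
    (hS : MeasurableSet {g : G | dist1 g < δ})
    (h3 : ∀ U ∈ B10Eq6DensityLevel.plaqSmall P G K ε₁, Real.exp (-c) ≤ (tower T g₀ E).ρ K U) :
    Real.exp (-c) * (((HaarData.haar : Measure G) {g : G | dist1 g < δ}).toReal) ^ Fintype.card (PBond P K) ≤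
      Real.exp (-E) * wilsonZ P G g₀ :=
  exp_neg_mul_wilsonZ_ge_I _ K (tower_isWilsonStart T g₀ E) hA (fun j _ => tower_preservesIntegral T g₀ E j)
    (tower_ρ_nonneg T g₀ E K) h4 hS h3

/-- **E pinned from above, for the tower:** `E ≤ log Z_W(g₀) + c + #bonds·log m⁻¹`. [cite: Balaban1985UV3, (6) p.257] -/
theorem tower_le_log_wilsonZ_add (T : ∀ k, RTOpI P k G (av k)) (g₀ E : ℝ)
    (hA : Measurable fun U : GaugeField P 0 G => wilsonAction4 U) (K : ℕ) {δ ε₁ c : ℝ} (h4 : 4 * δ ≤ ε₁)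
    (hS : MeasurableSet {g : G | dist1 g < δ})
    (hm : 0 < ((HaarData.haar : Measure G) {g : G | dist1 g < δ}).toReal)
    (h3 : ∀ U ∈ B10Eq6DensityLevel.plaqSmall P G K ε₁, Real.exp (-c) ≤ (tower T g₀ E).ρ K U) :
    E ≤ Real.log (wilsonZ P G g₀) + c +
      (Fintype.card (PBond P K) : ℝ) * Real.log ((HaarData.haar : Measure G) {g : G | dist1 g < δ}).toReal⁻¹ :=
  le_log_wilsonZ_add_I _ K (tower_isWilsonStart T g₀ E) hA (fun j _ => tower_preservesIntegral T g₀ E j)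
    (tower_ρ_nonneg T g₀ E K) h4 hS hm h3

/-- **E pinned from below, for the tower** (`DensityRGI.log_wilsonZ_sub_le` by name): `ρ_K ≤ e^{c′}` ⇒ `log Z_W(g₀) − c′ ≤ E`.
[cite: Balaban1985UV3, (6) p.257] -/
theorem tower_log_wilsonZ_sub_le (T : ∀ k, RTOpI P k G (av k)) (g₀ E : ℝ)
    (hA : Measurable fun U : GaugeField P 0 G => wilsonAction4 U) (K : ℕ) {c' : ℝ}
    (hup : ∀ V, (tower T g₀ E).ρ K V ≤ Real.exp c') :
    Real.log (wilsonZ P G g₀) - c' ≤ E :=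
  DensityRGI.log_wilsonZ_sub_le _ K (tower_isWilsonStart T g₀ E) hA (fun j _ => tower_preservesIntegral T g₀ E j) hup

/-- **The window for the vacuum-energy constant** *«E is a constant including normalization terms and vacuum energy
renormalization counterterms … we prefer to give an inductive definition during the proof»* (p. 256): the two-sided bound
(3)/(5)_K on `ρ_K` forces `log Z_W(g₀) − c′ ≤ E ≤ log Z_W(g₀) + c + #bonds·log m⁻¹` (cell GAPS G-pv06-1: E is not free).
[cite: Balaban1985UV3, (1) p.256, (6) p.257] -/
theorem tower_E_mem_Icc (T : ∀ k, RTOpI P k G (av k)) (g₀ E : ℝ)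
    (hA : Measurable fun U : GaugeField P 0 G => wilsonAction4 U) (K : ℕ) {δ ε₁ c c' : ℝ} (h4 : 4 * δ ≤ ε₁)
    (hS : MeasurableSet {g : G | dist1 g < δ})
    (hm : 0 < ((HaarData.haar : Measure G) {g : G | dist1 g < δ}).toReal)
    (h3 : ∀ U ∈ B10Eq6DensityLevel.plaqSmall P G K ε₁, Real.exp (-c) ≤ (tower T g₀ E).ρ K U)
    (hup : ∀ V, (tower T g₀ E).ρ K V ≤ Real.exp c') :
    E ∈ Set.Icc (Real.log (wilsonZ P G g₀) - c')
      (Real.log (wilsonZ P G g₀) + c +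
        (Fintype.card (PBond P K) : ℝ) * Real.log ((HaarData.haar : Measure G) {g : G | dist1 g < δ}).toReal⁻¹) :=
  ⟨tower_log_wilsonZ_sub_le T g₀ E hA K hup, tower_le_log_wilsonZ_add T g₀ E hA K h4 hS hm h3⟩

end LowerTower

section Unitary

variable {n : Type*} [DecidableEq n] [Fintype n] [Nonempty n] {P : Params}

/-- **(6), lower half, for the tower, `G = U(N)`, NO side input left** (`…UnitaryModel` instances; `hS`, `hm` from
`…B10Eq6DensityLevel` §3, `hA` from `RegularGaugeGroup`): `e^{−c} ≤ ρ_K` on the domain (4) `|U(∂p) − 1|_op < ε₁` ⇒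
`0 < m = Haar{|u − 1| < ε₁/4}` and `e^{−c}·m^{#bonds} ≤ e^{−E}Z_W(g₀)`. [cite: Balaban1985UV3, (6) p.257] -/
theorem tower_partitionFn_ge_unitaryGroup {av : ∀ j, Averaging P j (Matrix.unitaryGroup n ℂ)}
    (T : ∀ k, RTOpI P k (Matrix.unitaryGroup n ℂ) (av k)) (g₀ E : ℝ) (K : ℕ) {ε₁ c : ℝ} (hε₁ : 0 < ε₁)
    (h3 : ∀ U ∈ B10Eq6DensityLevel.plaqSmall P (Matrix.unitaryGroup n ℂ) K ε₁, Real.exp (-c) ≤ (tower T g₀ E).ρ K U) :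
    0 < ((HaarData.haar : Measure (Matrix.unitaryGroup n ℂ)) {u | dist1 u < ε₁ / 4}).toReal ∧
      Real.exp (-c) * (((HaarData.haar : Measure (Matrix.unitaryGroup n ℂ)) {u | dist1 u < ε₁ / 4}).toReal) ^
          Fintype.card (PBond P K) ≤ Real.exp (-E) * wilsonZ P (Matrix.unitaryGroup n ℂ) g₀ := by
  haveI : IsProbabilityMeasure (HaarData.haar : Measure (Matrix.unitaryGroup n ℂ)) := HaarData.isProb
  have hm : 0 < ((HaarData.haar : Measure (Matrix.unitaryGroup n ℂ)) {u | dist1 u < ε₁ / 4}).toReal :=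
    ENNReal.toReal_pos (B10Eq6DensityLevel.haar_dist1Lt_pos_unitaryGroup (by positivity)).ne' (measure_ne_top _ _)
  exact ⟨hm, tower_partitionFn_ge T g₀ E measurable_wilsonAction4_of_regular K (by linarith)
    (B10Eq6DensityLevel.measurableSet_dist1Lt _) h3⟩

/-- `G = U(N)`, the window for E with every side input discharged. [cite: Balaban1985UV3, (6) p.257] -/
theorem tower_E_mem_Icc_unitaryGroup {av : ∀ j, Averaging P j (Matrix.unitaryGroup n ℂ)}
    (T : ∀ k, RTOpI P k (Matrix.unitaryGroup n ℂ) (av k)) (g₀ E : ℝ) (K : ℕ) {ε₁ c c' : ℝ} (hε₁ : 0 < ε₁)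
    (h3 : ∀ U ∈ B10Eq6DensityLevel.plaqSmall P (Matrix.unitaryGroup n ℂ) K ε₁, Real.exp (-c) ≤ (tower T g₀ E).ρ K U)
    (hup : ∀ V, (tower T g₀ E).ρ K V ≤ Real.exp c') :
    E ∈ Set.Icc (Real.log (wilsonZ P (Matrix.unitaryGroup n ℂ) g₀) - c')
      (Real.log (wilsonZ P (Matrix.unitaryGroup n ℂ) g₀) + c +
        (Fintype.card (PBond P K) : ℝ) *
          Real.log ((HaarData.haar : Measure (Matrix.unitaryGroup n ℂ)) {u | dist1 u < ε₁ / 4}).toReal⁻¹) :=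
  tower_E_mem_Icc T g₀ E measurable_wilsonAction4_of_regular K (by linarith)
    (B10Eq6DensityLevel.measurableSet_dist1Lt _) (tower_partitionFn_ge_unitaryGroup T g₀ E K hε₁ h3).1 h3 hup

/-- **(6), lower half, for the tower, `G = SU(N)`, no side input left.** [cite: Balaban1985UV3, (6) p.257] -/
theorem tower_partitionFn_ge_specialUnitaryGroup {av : ∀ j, Averaging P j (Matrix.specialUnitaryGroup n ℂ)}
    (T : ∀ k, RTOpI P k (Matrix.specialUnitaryGroup n ℂ) (av k)) (g₀ E : ℝ) (K : ℕ) {ε₁ c : ℝ} (hε₁ : 0 < ε₁)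
    (h3 : ∀ U ∈ B10Eq6DensityLevel.plaqSmall P (Matrix.specialUnitaryGroup n ℂ) K ε₁,
      Real.exp (-c) ≤ (tower T g₀ E).ρ K U) :
    0 < ((HaarData.haar : Measure (Matrix.specialUnitaryGroup n ℂ)) {u | dist1 u < ε₁ / 4}).toReal ∧
      Real.exp (-c) * (((HaarData.haar : Measure (Matrix.specialUnitaryGroup n ℂ)) {u | dist1 u < ε₁ / 4}).toReal) ^
          Fintype.card (PBond P K) ≤ Real.exp (-E) * wilsonZ P (Matrix.specialUnitaryGroup n ℂ) g₀ := by
  haveI : IsProbabilityMeasure (HaarData.haar : Measure (Matrix.specialUnitaryGroup n ℂ)) := HaarData.isProb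
  have hm : 0 < ((HaarData.haar : Measure (Matrix.specialUnitaryGroup n ℂ)) {u | dist1 u < ε₁ / 4}).toReal :=
    ENNReal.toReal_pos (B10Eq6DensityLevel.haar_dist1Lt_pos_specialUnitaryGroup (by positivity)).ne'
      (measure_ne_top _ _)
  exact ⟨hm, tower_partitionFn_ge T g₀ E measurable_wilsonAction4_of_regular K (by linarith)
    (B10Eq6DensityLevel.measurableSet_dist1Lt _) h3⟩

end Unitary

/-! ## §6 Vacuity of the gen-7 carrier `Step.DensityRG` and EXISTENCE of the tower -/

section Existence

variable {P : Params} {G : Type*} [GaugeGroup G] [MeasurableSpace G] [HaarData G]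

/-- **VACUITY CERTIFICATE** for the carrier of `…B10Eq6DensityLevel` §2–§3 (cell GAPS G-f1-3 / DIVERGENCE F17, by name from
`…AveragingRT.isEmpty_rtOp_family`): in the standing range and `d ≥ 2`, if one level averages axially and the gauge group carries
a Haar-measurable set of measure strictly between 0 and 1 and a non-negative measurable non-integrable function, then there is NO
`D : Step.DensityRG P G av` — every theorem with that binder is vacuous for such data.  The present file's §2–§5 use
`Step.DensityRGI` instead. (typing certificate for the cell's carrier of (2); serves (2)/(6)) [cite: Balaban1985UV3, (2) p.256] -/
theorem isEmpty_densityRG [MeasurableMul₂ G] (av : ∀ k, Averaging P k G) (k₀ : ℕ) (hk₀ : k₀ + 1 ≤ P.m + P.K)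
    (hd : 2 ≤ P.d) (hav : (av k₀).avg = AveragingRT.axialAvg)
    (A : Set G) (hA : MeasurableSet A) (hA0 : HaarData.haar A ≠ 0) (hA1 : HaarData.haar A ≠ 1)
    (h₀ : G → ℝ) (h₀m : Measurable h₀) (h₀nn : ∀ g, 0 ≤ h₀ g) (h₀ni : ¬ Integrable h₀ (HaarData.haar (G := G))) :
    IsEmpty (DensityRG P G av) :=
  ⟨fun D => (AveragingRT.isEmpty_rtOp_family av k₀ hk₀ hd hav A hA hA0 hA1 h₀ h₀m h₀nn h₀ni).false D.T⟩

variable (P G)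

/-- **THE TOWER EXISTS:** (1)–(2) instantiated with the standard averaging family of `…AveragingRT` (axial decimation in the
standing range) and its integrable-density renormalization transformations `rtOpIStd` — a WITNESS that the bundle `(av, T)` the
tower is parametrised by is satisfiable on the carrier of record (HONEST SCOPE (i): not the paper's own averaging of [4]).
[cite: Balaban1985UV3, (2) p.256] -/
def towerStd [MeasurableMul₂ G] (g₀ E : ℝ) : DensityRGI P G (AveragingRT.stdAvg P G) :=
  tower (AveragingRT.rtOpIStd P G) g₀ E

variable {P G}

/-- `towerStd` is a Wilson start with identity large-field operations. [cite: Balaban1985UV3, (1)–(2) p.256] -/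
theorem towerStd_isWilsonStart [MeasurableMul₂ G] (g₀ E : ℝ) :
    (towerStd P G g₀ E).IsWilsonStart g₀ E ∧ ∀ k, (towerStd P G g₀ E).R k = id :=
  ⟨tower_isWilsonStart _ g₀ E, fun k => tower_R _ g₀ E k⟩

/-- Existence in `∃`-form: for some averaging family there is a density trajectory on the carrier of record which starts at (1)
and applies the transformations only ((2), no 𝐑). [cite: Balaban1985UV3, (1)–(2) p.256] -/
theorem exists_tower [MeasurableMul₂ G] (g₀ E : ℝ) :
    ∃ av : ∀ k, Averaging P k G, ∃ D : DensityRGI P G av, D.IsWilsonStart g₀ E ∧ ∀ k, D.R k = id :=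
  ⟨AveragingRT.stdAvg P G, towerStd P G g₀ E, towerStd_isWilsonStart g₀ E⟩

/-- (6) for the standard tower, every k, for a `RegularGaugeGroup`: `∫dV_kρ_k = e^{−E}Z_W(g₀)` with NO hypothesis left.
[cite: Balaban1985UV3, (6) p.257] -/
theorem integral_towerStd_eq [RegularGaugeGroup G] (g₀ E : ℝ) (k : ℕ) :
    ∫ V, (towerStd P G g₀ E).ρ k V ∂(fieldMeasure P k G) = Real.exp (-E) * wilsonZ P G g₀ :=
  integral_tower_eq_wilsonZ _ g₀ E measurable_wilsonAction4_of_regular k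

end Existence

/-! ## §7 Display (4): the characteristic function `χ` of the domain `|U(∂p) − 1| < ε₁` as a density factor -/

section Chi

variable (P : Params) (G : Type*) [GaugeGroup G]

/-- **(4)** p. 256: *«The function χ(U) is a characteristic function of the domain |U(∂p) − 1| < ε₁, p ⊂ T₁^{(K)}»* — as a
real density factor on `T^{(k)}` of `Setup` (the cell's `chiSmall` over ALL plaquettes; its support is the set
`…B10Eq6DensityLevel.plaqSmall P G k ε₁` of gen 7, `chi4_eq_one_iff`). [cite: Balaban1985UV3, (4) p.256] -/
def chi4 (ε₁ : ℝ) (k : ℕ) : Density P k G :=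
  chiSmall (Set.univ : Set (Plaq P k)) ε₁

variable {P G}

/-- The small-field condition on all plaquettes IS membership in the domain (4). (elementary; serves (4))
[cite: Balaban1985UV3, (4) p.256] -/
theorem plaqSmallOn_univ_iff {ε₁ : ℝ} {k : ℕ} {U : GaugeField P k G} :
    PlaqSmallOn (Set.univ : Set (Plaq P k)) ε₁ U ↔ U ∈ B10Eq6DensityLevel.plaqSmall P G k ε₁ := by
  simp [PlaqSmallOn, B10Eq6DensityLevel.mem_plaqSmall]

/-- `χ = 1` on the domain (4). [cite: Balaban1985UV3, (4) p.256] -/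
theorem chi4_eq_one_of_mem {ε₁ : ℝ} {k : ℕ} {U : GaugeField P k G} (hU : U ∈ B10Eq6DensityLevel.plaqSmall P G k ε₁) :
    chi4 P G ε₁ k U = 1 := by
  unfold chi4 chiSmall
  rw [if_pos (plaqSmallOn_univ_iff.mpr hU)]

/-- `χ = 0` off the domain (4). [cite: Balaban1985UV3, (4) p.256] -/
theorem chi4_eq_zero_of_not_mem {ε₁ : ℝ} {k : ℕ} {U : GaugeField P k G}
    (hU : U ∉ B10Eq6DensityLevel.plaqSmall P G k ε₁) : chi4 P G ε₁ k U = 0 := by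
  unfold chi4 chiSmall
  rw [if_neg (mt plaqSmallOn_univ_iff.mp hU)]

/-- `χ(U) = 1 ↔ U ∈ (4)`: `chi4` IS the characteristic function of the domain (4). [cite: Balaban1985UV3, (4) p.256] -/
theorem chi4_eq_one_iff {ε₁ : ℝ} {k : ℕ} {U : GaugeField P k G} :
    chi4 P G ε₁ k U = 1 ↔ U ∈ B10Eq6DensityLevel.plaqSmall P G k ε₁ := by
  refine ⟨fun h => ?_, chi4_eq_one_of_mem⟩
  by_contra hU
  rw [chi4_eq_zero_of_not_mem hU] at h
  exact zero_ne_one h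

/-- `χ` takes the values 0 and 1 only. (elementary; serves (4)) [cite: Balaban1985UV3, (4) p.256] -/
theorem chi4_eq_zero_or_one {ε₁ : ℝ} {k : ℕ} (U : GaugeField P k G) :
    chi4 P G ε₁ k U = 0 ∨ chi4 P G ε₁ k U = 1 := by
  by_cases hU : U ∈ B10Eq6DensityLevel.plaqSmall P G k ε₁
  · exact Or.inr (chi4_eq_one_of_mem hU)
  · exact Or.inl (chi4_eq_zero_of_not_mem hU)

/-- `0 ≤ χ ≤ 1`. (elementary; serves (4)) [cite: Balaban1985UV3, (4) p.256] -/
theorem chi4_mem_Icc {ε₁ : ℝ} {k : ℕ} (U : GaugeField P k G) : chi4 P G ε₁ k U ∈ Set.Icc (0 : ℝ) 1 := by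
  rcases chi4_eq_zero_or_one (ε₁ := ε₁) U with h | h <;> rw [h] <;> norm_num

variable (P G) in
/-- **(40)** p. 266 [PDF 12]: *«Finally characteristic functions χ_j are generalizations of the characteristic function χ₁ and
are defined by χ_j = Π_{p∈Λ_j} χ({|V_j(∂p) − 1| < 2L²g_{j−1}p(g_{j−1})}), j = 1, …, k, (40) where we have denoted V_k = V.»* —
the scale-j analogue of (4)'s χ as a real density factor on `T^{(j)}` of `Setup` (the cell's `chiSmall` over the plaquette set
`Λj`, threshold `2L²g_{j−1}p(g_{j−1})` with `p = B10.pFun b₀ p₀`); its support is the cell's abstract condition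
`…B10LargeField.Chi40` at `dev p := |V(∂p) − 1|` (`chi40_eq_one_iff`), and it IS the printed product of one-plaquette
characteristic functions (`chi40_eq_prod`). [cite: Balaban1985UV3, (40) p.266] -/
def chi40 {j : ℕ} (Λj : Set (Plaq P j)) (L gprev b₀ p₀ : ℝ) : Density P j G :=
  chiSmall Λj (2 * L ^ 2 * gprev * B10.pFun b₀ p₀ gprev)

/-- The support of χ_j IS the cell's (40)-condition `B10LargeField.Chi40` read with `dev p = |V(∂p) − 1|`
(`dist1 ∘ plaqHol`). [cite: Balaban1985UV3, (40) p.266] -/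
theorem chi40_eq_one_iff {j : ℕ} {Λj : Set (Plaq P j)} {L gprev b₀ p₀ : ℝ} {V : GaugeField P j G} :
    chi40 P G Λj L gprev b₀ p₀ V = 1 ↔
      B10LargeField.Chi40 Λj (fun p => dist1 (GaugeField.plaqHol V p)) L gprev b₀ p₀ := by
  unfold chi40 chiSmall
  by_cases h : PlaqSmallOn Λj (2 * L ^ 2 * gprev * B10.pFun b₀ p₀ gprev) V
  · rw [if_pos h]
    exact ⟨fun _ => h, fun _ => rfl⟩
  · rw [if_neg h]
    exact ⟨fun h01 => absurd h01 zero_ne_one, fun hc => absurd hc h⟩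

/-- χ_j written as the printed PRODUCT over `p ∈ Λ_j` of one-plaquette characteristic functions. [cite: Balaban1985UV3, (40) p.266] -/
theorem chi40_eq_prod {j : ℕ} (Λj : Set (Plaq P j)) [DecidablePred (· ∈ Λj)] (L gprev b₀ p₀ : ℝ)
    (V : GaugeField P j G) :
    chi40 P G Λj L gprev b₀ p₀ V =
      ∏ p ∈ Λj.toFinset,
        (if dist1 (GaugeField.plaqHol V p) < 2 * L ^ 2 * gprev * B10.pFun b₀ p₀ gprev then (1 : ℝ) else 0) := by
  classical
  rw [Finset.prod_boole]
  unfold chi40 chiSmall PlaqSmallOn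
  simp only [Set.mem_toFinset]
  congr 1

end Chi

/-! ## §8 Bridge to the abstract carrier `B10.RunData`: (5) and Theorem 1 READ on density towers -/

section Bridge

variable {P : Params} {G : Type} [GaugeGroup G] [MeasurableSpace G] [HaarData G] {av : ∀ j, Averaging P j G}

/-- A run of [Balaban1985UV3] in the cell's abstract record `B10.RunData` ((1)–(5) p. 256) WHOSE CONFIGURATION SPACES AND DENSITIES
ARE THOSE OF A DENSITY TOWER on the carrier of record: `Cfg k := GaugeField P k G`, `ρ := D.ρ`; the remaining fields — `χ k` (the
characteristic function of (4)/(47)), `wilsonBG k U = A^η(U_k(U))` (the minimal configuration of [7] = [Balaban1985Variational] and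
its fine action), `sites k = |T₁^{(k)}|`, `g k = g_k`, `Ineq41_47` — are the other rows' objects and enter as parameters.
[cite: Balaban1985UV3, (1)–(5) p.256] -/
def runData (D : DensityRGI P G av) (K : ℕ) (χ : ∀ k, Density P k G) (bgA : ∀ k, GaugeField P k G → ℝ)
    (sites g : ℕ → ℝ) (I : ℕ → Prop) : B10.RunData where
  K := K
  Cfg := fun k => GaugeField P k G
  ρ := D.ρ
  χ := χ
  wilsonBG := bgA
  sites := sites
  g := g
  Ineq41_47 := I

/-- The densities of the run are the tower's. [cite: Balaban1985UV3, (2) p.256] -/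
theorem runData_ρ (D : DensityRGI P G av) (K : ℕ) (χ : ∀ k, Density P k G) (bgA : ∀ k, GaugeField P k G → ℝ)
    (sites g : ℕ → ℝ) (I : ℕ → Prop) : (runData D K χ bgA sites g I).ρ = D.ρ := rfl

/-- The depth of the run. [cite: Balaban1985UV3, (2) p.256] -/
theorem runData_K (D : DensityRGI P G av) (K : ℕ) (χ : ∀ k, Density P k G) (bgA : ∀ k, GaugeField P k G → ℝ)
    (sites g : ℕ → ℝ) (I : ℕ → Prop) : (runData D K χ bgA sites g I).K = K := rfl

/-- **(5) at step k READ on the tower:** `B10.Bounds5At` for the run unfolds to the printed two-sided bound on `GaugeField P k G`,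
*«χ(U) exp[−(1/g_k²)A^η(U_k(U)) − O(1)|T₁^{(k)}|] ≤ ρ_k(U) ≤ exp O(1)|T₁^{(k)}|»*. [cite: Balaban1985UV3, (5) p.256] -/
theorem bounds5At_runData_iff (D : DensityRGI P G av) (K : ℕ) (χ : ∀ k, Density P k G)
    (bgA : ∀ k, GaugeField P k G → ℝ) (sites g : ℕ → ℝ) (I : ℕ → Prop) (O1 : ℝ) (k : ℕ) :
    B10.Bounds5At (runData D K χ bgA sites g I) O1 k ↔
      ∀ U : GaugeField P k G,
        χ k U * Real.exp (-((g k)⁻¹ ^ 2 * bgA k U) - O1 * sites k) ≤ D.ρ k U ∧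
          D.ρ k U ≤ Real.exp (O1 * sites k) :=
  Iff.rfl

/-- **(5) for the run READ on the tower** (all k ≤ K). [cite: Balaban1985UV3, (5) p.256] -/
theorem bounds5_runData_iff (D : DensityRGI P G av) (K : ℕ) (χ : ∀ k, Density P k G)
    (bgA : ∀ k, GaugeField P k G → ℝ) (sites g : ℕ → ℝ) (I : ℕ → Prop) (O1 : ℝ) :
    B10.Bounds5 (runData D K χ bgA sites g I) O1 ↔
      ∀ k, k ≤ K → ∀ U : GaugeField P k G,
        χ k U * Real.exp (-((g k)⁻¹ ^ 2 * bgA k U) - O1 * sites k) ≤ D.ρ k U ∧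
          D.ρ k U ≤ Real.exp (O1 * sites k) :=
  Iff.rfl

/-- **Theorem 1 READ on a family of towers** (one gauge group, one run per lattice approximation `i` with its own `Params`, i.e.
its own ε and torus): `B10.Thm1Printed` for the family of runs unfolds to «for every bounded set of couplings ONE constant O(1)
serves all i and all k ≤ K_i in (5)».  An unfolding only — nothing is asserted. [cite: Balaban1985UV3, Thm 1 p.257] -/
theorem thm1Printed_runData_iff {I : Type} (Pf : I → Params) {avf : ∀ i, ∀ j, Averaging (Pf i) j G}
    (D : ∀ i, DensityRGI (Pf i) G (avf i)) (K : I → ℕ) (χ : ∀ i, ∀ k, Density (Pf i) k G)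
    (bgA : ∀ i, ∀ k, GaugeField (Pf i) k G → ℝ) (sites g : I → ℕ → ℝ) (Iq : I → ℕ → Prop) :
    B10.Thm1Printed (fun i => runData (D i) (K i) (χ i) (bgA i) (sites i) (g i) (Iq i)) ↔
      ∀ gmax : ℝ, 0 < gmax → ∃ O1 : ℝ, ∀ i : I,
        (∀ k, k ≤ K i → 0 < g i k ∧ g i k ≤ gmax) →
          ∀ k, k ≤ K i → ∀ U : GaugeField (Pf i) k G,
            χ i k U * Real.exp (-((g i k)⁻¹ ^ 2 * bgA i k U) - O1 * sites i k) ≤ (D i).ρ k U ∧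
              (D i).ρ k U ≤ Real.exp (O1 * sites i k) :=
  Iff.rfl

/-- **«The bounds (5) imply bounds for partition functions», upper half, BY NAME from `B10.Bounds5At`:** (5) at k = K for the run of
the tower (1)–(2) ⇒ `Z^ε = e^{−E}Z_W(g₀) ≤ exp(O1·|T₁^{(K)}|)`. [cite: Balaban1985UV3, (5) p.256, (6) p.257] -/
theorem tower_partitionFn_le_of_bounds5At (T : ∀ k, RTOpI P k G (av k)) (g₀ E : ℝ)
    (hA : Measurable fun U : GaugeField P 0 G => wilsonAction4 U) {K : ℕ} {χ : ∀ k, Density P k G}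
    {bgA : ∀ k, GaugeField P k G → ℝ} {sites g : ℕ → ℝ} {I : ℕ → Prop} {O1 : ℝ}
    (h5 : B10.Bounds5At (runData (tower T g₀ E) K χ bgA sites g I) O1 K) :
    Real.exp (-E) * wilsonZ P G g₀ ≤ Real.exp (O1 * sites K) := by
  rw [← partitionFn_tower T g₀ E]
  exact partitionFn_tower_le_exp T g₀ E hA K fun V => ((bounds5At_runData_iff _ K χ bgA sites g I O1 K).mp h5 V).2

/-- **«The bounds (5) imply bounds for partition functions», lower half, BY NAME from `B10.Bounds5At`:** (5) at k = K for the
run of the tower, `χ_K = 1` on the domain (4) and the [7]-regularity input `A^η(U_K(U)) ≤ a·|T₁^{(K)}|` on (4) (as in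
`…B10Ineq3Terminal` / `…B10Eq5RegularAction`) ⇒ `exp(−(O1 + a·g_K^{−2})|T₁^{(K)}|)·m^{#bonds} ≤ e^{−E}Z_W(g₀)`.
[cite: Balaban1985UV3, (5) p.256, (6) p.257] -/
theorem tower_partitionFn_ge_of_bounds5At (T : ∀ k, RTOpI P k G (av k)) (g₀ E : ℝ)
    (hA : Measurable fun U : GaugeField P 0 G => wilsonAction4 U) {K : ℕ} {χ : ∀ k, Density P k G}
    {bgA : ∀ k, GaugeField P k G → ℝ} {sites g : ℕ → ℝ} {I : ℕ → Prop} {O1 a δ ε₁ : ℝ} (h4 : 4 * δ ≤ ε₁)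
    (hS : MeasurableSet {g : G | dist1 g < δ})
    (h5 : B10.Bounds5At (runData (tower T g₀ E) K χ bgA sites g I) O1 K)
    (hχ : ∀ U ∈ B10Eq6DensityLevel.plaqSmall P G K ε₁, χ K U = 1)
    (hreg : ∀ U ∈ B10Eq6DensityLevel.plaqSmall P G K ε₁, bgA K U ≤ a * sites K) :
    Real.exp (-((O1 + a * (g K)⁻¹ ^ 2) * sites K)) *
        (((HaarData.haar : Measure G) {g : G | dist1 g < δ}).toReal) ^ Fintype.card (PBond P K) ≤
      Real.exp (-E) * wilsonZ P G g₀ := by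
  rw [← partitionFn_tower T g₀ E]
  exact partitionFn_ge_of_bounds5_I _ K (fun j _ => tower_preservesIntegral T g₀ E j) (integrable_tower_zero T g₀ E hA)
    (partitionFn_tower_pos T g₀ E hA).ne' (tower_ρ_nonneg T g₀ E K) h4 hS hχ
    (fun U => ((bounds5At_runData_iff _ K χ bgA sites g I O1 K).mp h5 U).1) hreg

/-- **(5)_K ⇒ (6), lower half, with the χ of (5) THE characteristic function (4)** (`chi4`; the input «χ_K = 1 on the
domain (4)» of `tower_partitionFn_ge_of_bounds5At` discharged by `chi4_eq_one_of_mem`): `exp(−(O1 + a·g_K^{−2})|T₁^{(K)}|)·m^{#bonds}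
≤ e^{−E}Z_W(g₀)`. [cite: Balaban1985UV3, (4)–(5) p.256, (6) p.257] -/
theorem tower_partitionFn_ge_of_bounds5At_chi4 (T : ∀ k, RTOpI P k G (av k)) (g₀ E : ℝ)
    (hA : Measurable fun U : GaugeField P 0 G => wilsonAction4 U) {K : ℕ}
    {bgA : ∀ k, GaugeField P k G → ℝ} {sites g : ℕ → ℝ} {I : ℕ → Prop} {O1 a δ ε₁ : ℝ} (h4 : 4 * δ ≤ ε₁)
    (hS : MeasurableSet {g : G | dist1 g < δ})
    (h5 : B10.Bounds5At (runData (tower T g₀ E) K (chi4 P G ε₁) bgA sites g I) O1 K)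
    (hreg : ∀ U ∈ B10Eq6DensityLevel.plaqSmall P G K ε₁, bgA K U ≤ a * sites K) :
    Real.exp (-((O1 + a * (g K)⁻¹ ^ 2) * sites K)) *
        (((HaarData.haar : Measure G) {g : G | dist1 g < δ}).toReal) ^ Fintype.card (PBond P K) ≤
      Real.exp (-E) * wilsonZ P G g₀ :=
  tower_partitionFn_ge_of_bounds5At T g₀ E hA h4 hS h5 (fun _ hU => chi4_eq_one_of_mem hU) hreg

end Bridge


/-! ## §9 (v1.1) The tower at the paper՚s OWN averaging: Bałaban՚s block averaging, its Radon–Nikodym transformation, SU(2) hypothesis-free -/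

section Printed

variable {P : Params} {G : Type*} [GaugeGroup G]

variable (P G) in
/-- **The averaging family of «the renormalization transformations T described in [1,4]»** (p. 256): Bałaban՚s block averaging
`Ū(c) = M(U, c)` — the pub-balaban cell՚s `BlockAveraging.blockAvg ℰ` ([Balaban1987RG1] (0.4) p. 253, the tree՚s reading of
[Balaban1985Averaging] (15); the inner small-loop operation `ℰ` a parameter, printed instance `ExpMeanLog.expMeanLogSU`) — at every level
of the standing range `k + 1 ≤ m + K`, and the transport averaging `AveragingRT.stdAvg` beyond it (where `Setup`՚s tori have degenerated and
print has no lattice left). [cite: Balaban1985UV3, (2) p.256; Balaban1985Averaging, (15) p.19; Balaban1987RG1, (0.4) p.253] -/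
def blockAvgStd (ℰ : LoopAverage G) (k : ℕ) : Averaging P k G :=
  if k + 1 ≤ P.m + P.K then BlockAveraging.blockAvg ℰ else AveragingRT.stdAvg P G k

/-- In the standing range the family IS Bałaban՚s block averaging. [cite: Balaban1987RG1, (0.4) p.253] -/
theorem blockAvgStd_of_le (ℰ : LoopAverage G) {k : ℕ} (hk : k + 1 ≤ P.m + P.K) :
    blockAvgStd P G ℰ k = BlockAveraging.blockAvg ℰ := if_pos hk

/-- Beyond the standing range the family is the transport averaging. (plumbing) [cite: Balaban1985UV3, (2) p.256] -/
theorem blockAvgStd_of_not_le (ℰ : LoopAverage G) {k : ℕ} (hk : ¬ k + 1 ≤ P.m + P.K) :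
    blockAvgStd P G ℰ k = AveragingRT.stdAvg P G k := if_neg hk

/-- In the standing range the averaging MAP is `Ū = avgFun ℰ` = (0.4). [cite: Balaban1987RG1, (0.4) p.253] -/
theorem blockAvgStd_avg_of_le (ℰ : LoopAverage G) {k : ℕ} (hk : k + 1 ≤ P.m + P.K) :
    (blockAvgStd P G ℰ k).avg = BlockAveraging.avgFun ℰ := by
  rw [blockAvgStd_of_le ℰ hk]; rfl

variable [MeasurableSpace G] [HaarData G] [RegularGaugeGroup G]

variable (P G) in
/-- **The renormalization transformations of [1,4] for Bałaban՚s averaging, as operators on integrable densities** ([Balaban1985Averaging]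
(10) in the a.e. reading, cell DIVERGENCE F7): in the standing range the Radon–Nikodym transport `AveragingRT.rnTransport (avgFun ℰ)` of
`ρ dU` under `Ū` — an `RTOpI` by the pub-balaban cell՚s `T4FiniteEpsInhabited.isRT_rnTransport_of_ac` under the absolute-continuity
bracket `HaarAC (avgFun ℰ)` (row T4-D.G of that cell; taken as the hypothesis `hac`, discharged on SU(2) below) —, beyond it the transport
operator `AveragingRT.rtOpIStd`. [cite: Balaban1985Averaging, (10) p.19; Balaban1987RG1, (0.13) p.254] -/
def rtOpIBlockAvgStd (ℰ : LoopAverage G) (hE : ∀ n, Measurable fun W : Fin (n + 1) → G => ℰ.E W)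
    (hac : ∀ k, k + 1 ≤ P.m + P.K →
      T4FiniteEpsInhabited.HaarAC (BlockAveraging.avgFun ℰ : GaugeField P k G → GaugeField P (k + 1) G))
    (k : ℕ) : RTOpI P k G (blockAvgStd P G ℰ k) where
  T := if k + 1 ≤ P.m + P.K then AveragingRT.rnTransport (BlockAveraging.avgFun ℰ) else (AveragingRT.rtOpIStd P G k).T
  isRT := by
    intro ρ hρ
    by_cases hk : k + 1 ≤ P.m + P.K
    · rw [if_pos hk, blockAvgStd_avg_of_le ℰ hk]
      exact T4FiniteEpsInhabited.isRT_rnTransport_of_ac (BlockAveraging.avgFun ℰ)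
        (BlockAveraging.measurable_avgFun ℰ hE) (hac k hk) ρ hρ
    · rw [if_neg hk, blockAvgStd_of_not_le ℰ hk]
      exact (AveragingRT.rtOpIStd P G k).isRT ρ hρ
  pos := by
    intro ρ h0 V
    by_cases hk : k + 1 ≤ P.m + P.K
    · rw [if_pos hk]
      exact AveragingRT.rnTransport_nonneg _ ρ h0 V
    · rw [if_neg hk]
      exact (AveragingRT.rtOpIStd P G k).pos ρ h0 V

/-- In the standing range the transformation IS the Radon–Nikodym transport under Bałaban՚s `Ū`. [cite: Balaban1985Averaging, (10) p.19] -/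
theorem rtOpIBlockAvgStd_T_of_le (ℰ : LoopAverage G) (hE : ∀ n, Measurable fun W : Fin (n + 1) → G => ℰ.E W)
    (hac : ∀ k, k + 1 ≤ P.m + P.K →
      T4FiniteEpsInhabited.HaarAC (BlockAveraging.avgFun ℰ : GaugeField P k G → GaugeField P (k + 1) G))
    {k : ℕ} (hk : k + 1 ≤ P.m + P.K) :
    (rtOpIBlockAvgStd P G ℰ hE hac k).T = AveragingRT.rnTransport (BlockAveraging.avgFun ℰ) := by
  show (if k + 1 ≤ P.m + P.K then _ else _) = _
  rw [if_pos hk]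

variable (P G) in
/-- **(1)–(2) AT THE PAPER՚S OWN AVERAGING**: the density tower `ρ_{k+1} = T_kρ_k` from the Wilson start with `T_k` the transformation
of [1,4] for Bałaban՚s block averaging (under the `HaarAC` bracket `hac`).  This is the instance member owed by the SCOPE clause of row
B10.Eq2 (lead word 2026-08-23T09:00:45Z). [cite: Balaban1985UV3, (1)–(2) p.256] -/
def towerBlockAvg (ℰ : LoopAverage G) (hE : ∀ n, Measurable fun W : Fin (n + 1) → G => ℰ.E W)
    (hac : ∀ k, k + 1 ≤ P.m + P.K →
      T4FiniteEpsInhabited.HaarAC (BlockAveraging.avgFun ℰ : GaugeField P k G → GaugeField P (k + 1) G))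
    (g₀ E : ℝ) : DensityRGI P G (blockAvgStd P G ℰ) :=
  tower (rtOpIBlockAvgStd P G ℰ hE hac) g₀ E

/-- (2) along Bałaban՚s averaging, written out in the standing range: `ρ_{k+1}` is the Radon–Nikodym transport of `ρ_k dU` under
`Ū = avgFun ℰ`. [cite: Balaban1985UV3, (2) p.256] -/
theorem towerBlockAvg_ρ_succ_of_le (ℰ : LoopAverage G) (hE : ∀ n, Measurable fun W : Fin (n + 1) → G => ℰ.E W)
    (hac : ∀ k, k + 1 ≤ P.m + P.K →
      T4FiniteEpsInhabited.HaarAC (BlockAveraging.avgFun ℰ : GaugeField P k G → GaugeField P (k + 1) G))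
    (g₀ E : ℝ) {k : ℕ} (hk : k + 1 ≤ P.m + P.K) :
    (towerBlockAvg P G ℰ hE hac g₀ E).ρ (k + 1) =
      AveragingRT.rnTransport (BlockAveraging.avgFun ℰ) ((towerBlockAvg P G ℰ hE hac g₀ E).ρ k) := by
  show (rtOpIBlockAvgStd P G ℰ hE hac k).T ((towerBlockAvg P G ℰ hE hac g₀ E).ρ k) = _
  rw [rtOpIBlockAvgStd_T_of_le ℰ hE hac hk]

/-- **(6) for the tower at Bałaban՚s averaging**, every k, no hypothesis beyond the bracket: `∫dV_kρ_k = e^{−E}Z_W(g₀)`.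
[cite: Balaban1985UV3, (6) p.257] -/
theorem integral_towerBlockAvg_eq (ℰ : LoopAverage G) (hE : ∀ n, Measurable fun W : Fin (n + 1) → G => ℰ.E W)
    (hac : ∀ k, k + 1 ≤ P.m + P.K →
      T4FiniteEpsInhabited.HaarAC (BlockAveraging.avgFun ℰ : GaugeField P k G → GaugeField P (k + 1) G))
    (g₀ E : ℝ) (k : ℕ) :
    ∫ V, (towerBlockAvg P G ℰ hE hac g₀ E).ρ k V ∂(fieldMeasure P k G) = Real.exp (-E) * wilsonZ P G g₀ :=
  integral_tower_eq_wilsonZ _ g₀ E measurable_wilsonAction4_of_regular k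

end Printed

section PrintedSU

variable (P : Params)

/-- **(1)–(2) ON SU(2) WITH THE PRINTED AVERAGING, NO HYPOTHESIS**: Bałaban՚s block averaging driven by the printed inner operation
`{W_i} ↦ exp[|I|⁻¹ Σ_i log W_i]` (`ExpMeanLog.expMeanLogSU`, measurable at every arity by `ExpMeanLog.measurable_expMeanLogSU_E`), whose `HaarAC` bracket
the pub-balaban cell DISCHARGES on SU(2) in the standing range (`BlockAveragingEMLHaarAC.haarAC_avgFun_expMeanLogSU_of_le`).
[cite: Balaban1985UV3, (1)–(2) p.256; Balaban1987RG1, (0.4) p.253] -/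
def towerPrintedSU2 (g₀ E : ℝ) :
    DensityRGI P (Matrix.specialUnitaryGroup (Fin 2) ℂ) (blockAvgStd P (Matrix.specialUnitaryGroup (Fin 2) ℂ) ExpMeanLog.expMeanLogSU) :=
  towerBlockAvg P (Matrix.specialUnitaryGroup (Fin 2) ℂ) ExpMeanLog.expMeanLogSU ExpMeanLog.measurable_expMeanLogSU_E
    (fun _ hk => BlockAveragingEMLHaarAC.haarAC_avgFun_expMeanLogSU_of_le hk) g₀ E

/-- **(6) on SU(2) for the tower with the printed averaging, hypothesis-free**: `∫dV_kρ_k = e^{−E}Z_W(g₀)` for every k.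
[cite: Balaban1985UV3, (6) p.257] -/
theorem integral_towerPrintedSU2_eq (g₀ E : ℝ) (k : ℕ) :
    ∫ V, (towerPrintedSU2 P g₀ E).ρ k V ∂(fieldMeasure P k (Matrix.specialUnitaryGroup (Fin 2) ℂ)) =
      Real.exp (-E) * wilsonZ P (Matrix.specialUnitaryGroup (Fin 2) ℂ) g₀ :=
  integral_towerBlockAvg_eq _ _ _ g₀ E k

/-- ρ_{k+1} on SU(2) IS the Radon–Nikodym transport of ρ_k under the printed `Ū` (standing range). [cite: Balaban1985UV3, (2) p.256] -/
theorem towerPrintedSU2_ρ_succ_of_le (g₀ E : ℝ) {k : ℕ} (hk : k + 1 ≤ P.m + P.K) :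
    (towerPrintedSU2 P g₀ E).ρ (k + 1) =
      AveragingRT.rnTransport (BlockAveraging.avgFun ExpMeanLog.expMeanLogSU) ((towerPrintedSU2 P g₀ E).ρ k) :=
  towerBlockAvg_ρ_succ_of_le _ _ _ g₀ E hk

/-- **(1)–(2) ON SU(N) WITH THE PRINTED AVERAGING** under the pub-balaban cell՚s fibre law `EMLFibreLaw (Fin N)` (its row T4-D.G
contract for general N; met at N = 2 by `BlockAveragingEMLHaarACSUN.emlFibreLaw_fin_two`). [cite: Balaban1985UV3, (1)–(2) p.256; Balaban1987RG1, (0.4) p.253] -/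
def towerPrintedSUN {N : ℕ} [NeZero N] (hFib : BlockAveragingEMLHaarACSUN.EMLFibreLaw (Fin N)) (g₀ E : ℝ) :
    DensityRGI P (Matrix.specialUnitaryGroup (Fin N) ℂ) (blockAvgStd P (Matrix.specialUnitaryGroup (Fin N) ℂ) ExpMeanLog.expMeanLogSU) :=
  towerBlockAvg P (Matrix.specialUnitaryGroup (Fin N) ℂ) ExpMeanLog.expMeanLogSU ExpMeanLog.measurable_expMeanLogSU_E
    (fun _ hk => BlockAveragingEMLHaarACSUN.haarAC_avgFun_expMeanLogSU_of_fibreLaw hFib hk) g₀ E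

/-- (6) on SU(N) for the tower with the printed averaging, under the fibre law. [cite: Balaban1985UV3, (6) p.257] -/
theorem integral_towerPrintedSUN_eq {N : ℕ} [NeZero N] (hFib : BlockAveragingEMLHaarACSUN.EMLFibreLaw (Fin N)) (g₀ E : ℝ) (k : ℕ) :
    ∫ V, (towerPrintedSUN P hFib g₀ E).ρ k V ∂(fieldMeasure P k (Matrix.specialUnitaryGroup (Fin N) ℂ)) =
      Real.exp (-E) * wilsonZ P (Matrix.specialUnitaryGroup (Fin N) ℂ) g₀ :=
  integral_towerBlockAvg_eq _ _ _ g₀ E k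

/-- The SU(2) tower is the N = 2 fibre-law tower (the law met by `emlFibreLaw_fin_two`): same densities. [cite: Balaban1985UV3, (2) p.256] -/
theorem towerPrintedSUN_two_ρ (g₀ E : ℝ) :
    (towerPrintedSUN P BlockAveragingEMLHaarACSUN.emlFibreLaw_fin_two g₀ E).ρ = (towerPrintedSU2 P g₀ E).ρ := rfl

end PrintedSU

/-! ## §10 (v1.2) SU(N), EVERY N ≥ 1, HYPOTHESIS-FREE: the fibre law is the tree՚s theorem `BlockAveragingEMLFibreLawSUN.emlFibreLaw_fin`

Theorem 1 (p. 257 [PDF 3]) is stated for «a semi-simple compact group Lie G»; its classical model family is SU(N), N ≥ 2.  §9՚s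
`towerPrintedSUN` carried the pub-balaban cell՚s fibre law `EMLFibreLaw (Fin N)` as a hypothesis `hFib`; that law has been a theorem of
the tree for every `N ≥ 1` since 2026-08-19 — `BlockAveragingEMLFibreLawSUN.emlFibreLaw_fin` (from the tangent injectivity of the ambient
exp-mean-log map, `T4EMLTangentInjective.emlTangentLaw_specialUnitary`, and Lemma A `T4HaarSUNLocalDiffeo`), with
`BlockAveragingEMLFibreLawSUN.haarAC_avgFun_expMeanLogSU_SUN` the resulting `HaarAC` bracket of (0.4) at the PRINTED small-loop average on every
torus of the standing range.  This section discharges `hFib` BY NAME: nothing new is proved about the averaging; the value is that rows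
B10.Eq1 ∕ B10.Eq2 at the paper՚s own T hold on SU(N) for every N with NO hypothesis (v1.1: N = 2 only). -/

section PrintedSUNFree

variable (P : Params)

/-- **(1)–(2) ON SU(N), EVERY N ≥ 1, WITH THE PRINTED AVERAGING AND NO HYPOTHESIS**: Bałaban՚s block averaging driven by the printed
inner operation `{W_i} ↦ exp[|I|⁻¹ Σ_i log W_i]` (`ExpMeanLog.expMeanLogSU`), its Radon–Nikodym transformation in the standing range, the
`HaarAC` bracket discharged by the tree՚s fibre law `BlockAveragingEMLFibreLawSUN.emlFibreLaw_fin` (= §9՚s `towerPrintedSUN` at that witness).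
[cite: Balaban1985UV3, (1)–(2) p.256, Thm 1 p.257; Balaban1987RG1, (0.4) p.253] -/
def towerPrintedSUNFree {N : ℕ} [NeZero N] (g₀ E : ℝ) :
    DensityRGI P (Matrix.specialUnitaryGroup (Fin N) ℂ)
      (blockAvgStd P (Matrix.specialUnitaryGroup (Fin N) ℂ) ExpMeanLog.expMeanLogSU) :=
  towerPrintedSUN P BlockAveragingEMLFibreLawSUN.emlFibreLaw_fin g₀ E

/-- `towerPrintedSUNFree` IS §9՚s fibre-law tower at the tree՚s witness `emlFibreLaw_fin` (definitional). [cite: Balaban1985UV3, (2) p.256] -/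
theorem towerPrintedSUNFree_eq {N : ℕ} [NeZero N] (g₀ E : ℝ) :
    towerPrintedSUNFree P (N := N) g₀ E = towerPrintedSUN P BlockAveragingEMLFibreLawSUN.emlFibreLaw_fin g₀ E := rfl

/-- **Every fibre-law witness gives the same densities** (the witness enters only the PROOF field `isRT` of the transformation
`rtOpIBlockAvgStd`; proof irrelevance): §9՚s conditional tower and the hypothesis-free tower have the same `ρ_k` for all k.
[cite: Balaban1985UV3, (2) p.256] -/
theorem towerPrintedSUN_ρ_eq_free {N : ℕ} [NeZero N] (hFib : BlockAveragingEMLHaarACSUN.EMLFibreLaw (Fin N)) (g₀ E : ℝ) :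
    (towerPrintedSUN P hFib g₀ E).ρ = (towerPrintedSUNFree P (N := N) g₀ E).ρ := rfl

/-- **(6) on SU(N), every N ≥ 1, for the tower with the printed averaging, hypothesis-free**: `∫dV_kρ_k = e^{−E}Z_W(g₀)` for every k.
[cite: Balaban1985UV3, (6) p.257] -/
theorem integral_towerPrintedSUNFree_eq {N : ℕ} [NeZero N] (g₀ E : ℝ) (k : ℕ) :
    ∫ V, (towerPrintedSUNFree P (N := N) g₀ E).ρ k V ∂(fieldMeasure P k (Matrix.specialUnitaryGroup (Fin N) ℂ)) =
      Real.exp (-E) * wilsonZ P (Matrix.specialUnitaryGroup (Fin N) ℂ) g₀ :=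
  integral_towerPrintedSUN_eq P BlockAveragingEMLFibreLawSUN.emlFibreLaw_fin g₀ E k

/-- (2) on SU(N), every N ≥ 1, written out in the standing range `k + 1 ≤ m + K`: `ρ_{k+1}` IS the Radon–Nikodym transport of `ρ_k dU`
under the printed `Ū = avgFun expMeanLogSU` of (0.4), no hypothesis. [cite: Balaban1985UV3, (2) p.256; Balaban1985Averaging, (10) p.19] -/
theorem towerPrintedSUNFree_ρ_succ_of_le {N : ℕ} [NeZero N] (g₀ E : ℝ) {k : ℕ} (hk : k + 1 ≤ P.m + P.K) :
    (towerPrintedSUNFree P (N := N) g₀ E).ρ (k + 1) =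
      AveragingRT.rnTransport (BlockAveraging.avgFun ExpMeanLog.expMeanLogSU) ((towerPrintedSUNFree P (N := N) g₀ E).ρ k) :=
  towerBlockAvg_ρ_succ_of_le _ _ _ g₀ E hk

/-- The `HaarAC` bracket that §9՚s `towerBlockAvg` consumes, AT THE PRINTED AVERAGE ON SU(N), every N ≥ 1 and every level of the standing
range — the tree՚s theorem `BlockAveragingEMLFibreLawSUN.haarAC_avgFun_expMeanLogSU_SUN`, restated in this file՚s binder shape (the `hac`
argument of `rtOpIBlockAvgStd` ∕ `towerBlockAvg`). [cite: Balaban1987RG1, (0.4) p.253, (0.13) p.254] -/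
theorem hac_expMeanLogSU_SUN {N : ℕ} [NeZero N] :
    ∀ k, k + 1 ≤ P.m + P.K →
      T4FiniteEpsInhabited.HaarAC
        (BlockAveraging.avgFun ExpMeanLog.expMeanLogSU :
          GaugeField P k (Matrix.specialUnitaryGroup (Fin N) ℂ) → GaugeField P (k + 1) (Matrix.specialUnitaryGroup (Fin N) ℂ)) :=
  fun _ hk => BlockAveragingEMLFibreLawSUN.haarAC_avgFun_expMeanLogSU_SUN hk

/-- The hypothesis-free SU(N) tower IS §9՚s `towerBlockAvg` at the printed inner operation with the bracket `hac_expMeanLogSU_SUN`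
(definitional; the two `hac` proofs differ, the data do not). [cite: Balaban1985UV3, (2) p.256] -/
theorem towerPrintedSUNFree_eq_towerBlockAvg {N : ℕ} [NeZero N] (g₀ E : ℝ) :
    towerPrintedSUNFree P (N := N) g₀ E =
      towerBlockAvg P (Matrix.specialUnitaryGroup (Fin N) ℂ) ExpMeanLog.expMeanLogSU ExpMeanLog.measurable_expMeanLogSU_E
        (hac_expMeanLogSU_SUN P) g₀ E := rfl

/-- At N = 2 the hypothesis-free SU(N) tower is §9՚s `towerPrintedSU2` (same densities; the SU(2) bracket there came from the quaternionic
`BlockAveragingEMLHaarAC.haarAC_avgFun_expMeanLogSU_of_le`). [cite: Balaban1985UV3, (2) p.256] -/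
theorem towerPrintedSUNFree_two_ρ (g₀ E : ℝ) :
    (towerPrintedSUNFree P (N := 2) g₀ E).ρ = (towerPrintedSU2 P g₀ E).ρ := rfl

/-- **(6), lower half, on SU(N) for the hypothesis-free printed tower, no side input left** (§5՚s `tower_partitionFn_ge_specialUnitaryGroup`
at this tower): `e^{−c} ≤ ρ_K` on the domain (4) ⇒ `0 < m = Haar{|u − 1| < ε₁/4}` and `e^{−c}·m^{#bonds} ≤ e^{−E}Z_W(g₀)`.
[cite: Balaban1985UV3, (6) p.257] -/
theorem towerPrintedSUNFree_partitionFn_ge {N : ℕ} [NeZero N] (g₀ E : ℝ) (K : ℕ) {ε₁ c : ℝ} (hε₁ : 0 < ε₁)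
    (h3 : ∀ U ∈ B10Eq6DensityLevel.plaqSmall P (Matrix.specialUnitaryGroup (Fin N) ℂ) K ε₁,
      Real.exp (-c) ≤ (towerPrintedSUNFree P (N := N) g₀ E).ρ K U) :
    0 < ((HaarData.haar : Measure (Matrix.specialUnitaryGroup (Fin N) ℂ)) {u | dist1 u < ε₁ / 4}).toReal ∧
      Real.exp (-c) *
          (((HaarData.haar : Measure (Matrix.specialUnitaryGroup (Fin N) ℂ)) {u | dist1 u < ε₁ / 4}).toReal) ^
            Fintype.card (PBond P K) ≤
        Real.exp (-E) * wilsonZ P (Matrix.specialUnitaryGroup (Fin N) ℂ) g₀ :=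
  tower_partitionFn_ge_specialUnitaryGroup _ g₀ E K hε₁ h3

end PrintedSUNFree

end Literature.MathematicalPhysics.QuantumFieldTheory.Balaban1983to89.B10Eq2DensityTower

end
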